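import Literature.NumberTheory.EllipticCurves.KubertTateFiveEisensteinTwist
import Literature.NumberTheory.EllipticCurves.KubertTateM223ShaFive
import Literature.NumberTheory.EllipticCurves.LocalReductionKrausMinimality
import Literature.NumberTheory.EllipticCurves.ComplexMultiplicationLocalFactorsAux
import Literature.NumberTheory.EllipticCurves.OrdinaryPrimesProofs
import Literature.NumberTheory.EllipticCurves.QuadraticTwistSelmerPInfty
import Literature.NumberTheory.EllipticCurves.Rank1Residual.GVParityTwistProofs
import Literature.NumberTheory.EllipticCurves.MazurTorsionGaloisStructureProofs
import Mathlib.Tactic.NormNum.Prime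
import HarnessLib

/-!
# The Eisenstein twist `E_{-2/23}^{(-3)}`: RANK `0`, `t₅ = 0` unconditionally, and its minimal model
# `[1, −613, −12, 121470, −7796228]` — a NON-anomalous Eisenstein prime `5` (`a₅ = −1`), `corank_{ℤ₅} Sel_{5^∞} = 0`

PROOF-ONLY file (theorems only, no definition, no named fact, no `sorry`), topic `NumberTheory/EllipticCurves`; the first row of the
Eisenstein-twist table (class-wide criterion `KubertTateEisensteinTwist.twist_rank_zero_three`: Eisenstein-tame `E_{m,n}`, full `ℚ`-box,
`ω₂(mn) = 0` ⟹ `rank E^{(-3)}(ℚ) = 0`, `t₅(E^{(-3)}) = 0`).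

`E = E_{-2/23} = [25, 46, 1058, 0, 0]` (tree `KubertTateM223Descent`: rank `1`, box full, `Δ = 2⁵·19·23⁵`, bad primes `2, 19, 23 ≡ 2, 4, 3 (mod 5)`,
`19 ≡ 1 (mod 3)`: EISENSTEIN-TAME; `mn = -46 = -2·23`, both primes `≡ 2 (mod 3)`: `ω₂ = 0`).  Results:

* `twist_M2_23` — **`rank E_{-2/23}^{(-3)}(ℚ) = 0`, `t₅(E_{-2/23}^{(-3)}/ℚ) = 0`, `t₅(E_{-2/23}/ℚ) = 0`** (descent over `ℚ(ζ₃)`, no `L`-function).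
* the twist `quadraticTwist (-3) = [0, −2427/4, 0, 119025, −7555707]` is `ℚ`-isomorphic (`⟨1, 2, −1/2, 5⟩ • W = …`) to the integer model
  **`W = [1, −613, −12, 121470, −7796228]`**, globally minimal (`Δ_W = 2⁵·3⁶·19·23⁵`, no `q¹² ∣ Δ`); `#W̃(𝔽₅) = 7`, so **`a₅(W) = −1`**:
  `5` is a prime of good ORDINARY reduction with `W[5]` REDUCIBLE (twist of a curve with a rational `5`-torsion point) and
  `a₅ ≢ 1 (mod 5)` — **`¬ Anom W 5`**, i.e. `(W, 5)` is a NON-anomalous Eisenstein pair (`5` is inert in `ℚ(√-3)`, so the isogeny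
  character `χ₋₃` is non-trivial on `G_5`), inside the printed scope of Castella–Grossi–Lee–Skinner's `p`-converse (Thm. E, `r = 0`);
* `mordellWeilRank_model`, `selmerCorank_model_five` — `rank W(ℚ) = 0` and **`corank_{ℤ₅} Sel_{5^∞}(W/ℚ) = 0`** (transport along the
  isomorphism: tree `mordellWeilRank_variableChange_holds`, `selmerCorank_eq_of_variableChange`, Greenberg's `corank Sel = rank + t`).

Transfer statement T (stmt-BirchSwinnertonDyer-22356) instrument: the Summits reading feeds `selmerCorank_model_five` to CGLS Thm. E (`r = 0`)
and GZK, after which `Ш(W/ℚ)` is finite and T holds AT THIS CURVE modulo those two refereed facts.  BSD is not proved by this.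

## References

* [SilvermanAEC2009] J. H. Silverman, *AEC*, 2nd ed., III.1 Table 3.1, VII.1 Remark 1.1, VII.3.1(b), X.§2, Exercise 10.16.
* [Fisher2001FiveSevenDescent] T. Fisher, JEMS 3 (2001), §§1–2.
* [CastellaGrossiLeeSkinner2022] F. Castella, G. Grossi, J. Lee, C. Skinner, Invent. Math. 227 (2022), Thm. E.
* [Mazur1977] B. Mazur, *Modular curves and the Eisenstein ideal*, Ch. III §5.
-/

noncomputable section

open scoped Classical
open WeierstrassCurve Literature.NumberTheory.EllipticCurves
open Literature.NumberTheory.EllipticCurves.Rank1Residual.X11RankOneCertificates (discOf c4Of c6Of)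
open Literature.NumberTheory.EllipticCurves.Rank1Residual

namespace Literature.NumberTheory.EllipticCurves

namespace KubertTateM223EisensteinTwist

/-! ## §1 The base curve `E_{-2/23}`: Eisenstein tameness, `ω = 2`, `ω₂ = 0` -/

/-- **Eisenstein tameness of `E_{-2/23}`**: bad primes `2, 19, 23 ≢ 1 (mod 5)`; `19 ≡ 4 (mod 5)` is `≡ 1 (mod 3)` (split in `ℤ[ζ₃]`).
[cite: Fisher2001FiveSevenDescent, §2] -/
theorem eisenstein_tame : ∀ ℓ : ℕ, ℓ.Prime → (ℓ : ℤ) ∣ (kubertTateFive (-2 : ℤ) 23).Δ →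
    ℓ % 5 ≠ 1 ∧ (ℓ % 5 = 4 → ℓ % 3 = 1) := by
  intro p hp hdvd
  refine ⟨KubertTateM223Descent.tame p hp hdvd, fun h4 ↦ ?_⟩
  rw [KubertTateM223Descent.Δ_int] at hdvd
  have hdvdN : p ∣ 2 ^ 5 * 19 * 23 ^ 5 := by
    have h' : (p : ℤ) ∣ ((2 ^ 5 * 19 * 23 ^ 5 : ℕ) : ℤ) := by
      have e : ((2 ^ 5 * 19 * 23 ^ 5 : ℕ) : ℤ) = 3913296544 := by norm_num
      rw [e]; exact hdvd
    exact Int.natCast_dvd_natCast.mp h'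
  have hpi := Nat.Prime.prime hp
  rcases hpi.dvd_or_dvd hdvdN with h | h
  · rcases hpi.dvd_or_dvd h with h | h
    · have := (Nat.prime_dvd_prime_iff_eq hp Nat.prime_two).mp (hpi.dvd_of_dvd_pow h); omega
    · have := (Nat.prime_dvd_prime_iff_eq hp (by norm_num : Nat.Prime 19)).mp h; omega
  · have := (Nat.prime_dvd_prime_iff_eq hp (by norm_num : Nat.Prime 23)).mp (hpi.dvd_of_dvd_pow h); omega

/-- `ω(46) = 2` and `ω₂(46) = 0` (`46 = 2·23`, both `≡ 2 (mod 3)`). [folklore] -/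
private theorem card_primeFactors :
    (((-2 : ℤ) * 23).natAbs.primeFactors).card = 2 ∧ ((((-2 : ℤ) * 23).natAbs.primeFactors.filter (fun ℓ ↦ ℓ % 3 = 1))).card = 0 := by
  have e : ((-2 : ℤ) * 23).natAbs = 2 * 23 := by norm_num
  rw [e, Nat.primeFactors_mul (by norm_num) (by norm_num), Nat.Prime.primeFactors Nat.prime_two,
    Nat.Prime.primeFactors (by norm_num : Nat.Prime 23)]
  exact ⟨by decide, by decide⟩

/-- The twist by `-3` is elliptic (`-3 ≠ 0`). [cite: SilvermanAEC2009, X.§2] -/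
theorem isElliptic_twist :
    haveI := KubertTateM223Descent.isElliptic
    ((kubertTateFive (((-2 : ℤ) : ℚ)) (((23 : ℤ) : ℚ))).quadraticTwist (-3)).IsElliptic := by
  haveI := KubertTateM223Descent.isElliptic
  exact isElliptic_quadraticTwist _ (by norm_num)

/-! ## §2 The door at `5` on the twist: rank `0`, `t₅ = 0` -/

/-- **`rank E_{-2/23}^{(-3)}(ℚ) = 0`, `t₅(E_{-2/23}^{(-3)}/ℚ) = 0`, `t₅(E_{-2/23}/ℚ) = 0` — unconditionally, by the `5`-descent over `ℚ(ζ₃)`**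
(class-wide `KubertTateEisensteinTwist.twist_rank_zero_three`: Eisenstein-tame, full `ℚ`-box (`rank E(ℚ) = 1 = ω − 1`), `ω₂ = 0`; reference
point `(-70, 300)`, good prime `3`). [cite: SilvermanAEC2009, Thm. X.4.2 and Exercise 10.16] [cite: Fisher2001FiveSevenDescent, §2] -/
theorem twist_M2_23 :
    haveI := isElliptic_twist
    ((kubertTateFive (((-2 : ℤ) : ℚ)) (((23 : ℤ) : ℚ))).quadraticTwist (-3)).mordellWeilRank = 0 ∧
      ((kubertTateFive (((-2 : ℤ) : ℚ)) (((23 : ℤ) : ℚ))).quadraticTwist (-3)).shaCorank 5 = 0 ∧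
      (kubertTateFive (((-2 : ℤ) : ℚ)) (((23 : ℤ) : ℚ))).shaCorank 5 = 0 := by
  haveI := KubertTateM223Descent.isElliptic
  haveI := isElliptic_twist
  haveI : Fact (Nat.Prime 3) := ⟨Nat.prime_three⟩
  have hP : (kubertTateFive (((-2 : ℤ) : ℚ)) (((23 : ℤ) : ℚ))).toAffine.Nonsingular (-70) 300 :=
    (KubertTateM223Descent.nonsingular_iff _ _).mpr (by norm_num)
  obtain ⟨hω, hω₂⟩ := card_primeFactors
  have hr : ((-2 : ℤ) * 23).natAbs.primeFactors.card ≤ (kubertTateFive (((-2 : ℤ) : ℚ)) (((23 : ℤ) : ℚ))).mordellWeilRank + 1 := by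
    rw [hω, KubertTateM223Descent.mordellWeilRank_eq]
  exact KubertTateEisensteinTwist.twist_rank_zero_three (-2) 23 KubertTateM223Descent.not_five_dvd_Δ eisenstein_tame hP
    (by norm_num) (by norm_num) 3 (by norm_num) (by norm_num) KubertTateM223Descent.not_tor_dvd_Δ hr hω₂

/-! ## §3 The minimal model `W = [1, −613, −12, 121470, −7796228]` of the twist and the Eisenstein prime `5` -/

/-- **`E_{-2/23}^{(-3)} = [0, −2427/4, 0, 119025, −7555707]`** (`b₂ = 809`, `b₄ = 26450`, `b₆ = 1119364`; NOT an integral model).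
[cite: SilvermanAEC2009, X.§2] -/
theorem twist_eq : (kubertTateFive (((-2 : ℤ) : ℚ)) (((23 : ℤ) : ℚ))).quadraticTwist (-3) =
    (⟨0, -2427 / 4, 0, 119025, -7555707⟩ : WeierstrassCurve ℚ) := by
  rw [KubertTateM223Descent.curve_eq]
  ext <;> simp [quadraticTwist, WeierstrassCurve.b₂, WeierstrassCurve.b₄, WeierstrassCurve.b₆] <;> norm_num

/-- **The integer model `W = [1, −613, −12, 121470, −7796228]` is `ℚ`-isomorphic to the twist**: `⟨1, 2, −1/2, 5⟩ • W = E_{-2/23}^{(-3)}`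
(`x = x' + 2`, `y = y' − x'/2 + 5`). [cite: SilvermanAEC2009, III.1 Table 3.1] -/
theorem variableChange_model :
    (⟨1, 2, -1 / 2, 5⟩ : VariableChange ℚ) •
        (⟨((1 : ℤ) : ℚ), ((-613 : ℤ) : ℚ), ((-12 : ℤ) : ℚ), ((121470 : ℤ) : ℚ), ((-7796228 : ℤ) : ℚ)⟩ : WeierstrassCurve ℚ) =
      (kubertTateFive (((-2 : ℤ) : ℚ)) (((23 : ℤ) : ℚ))).quadraticTwist (-3) := by
  rw [twist_eq]
  ext <;> simp [variableChange_a₁, variableChange_a₂, variableChange_a₃, variableChange_a₄, variableChange_a₆] <;> norm_num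

/-- The model `W` is elliptic. [cite: SilvermanAEC2009, X.§2] -/
theorem isElliptic_model :
    (⟨((1 : ℤ) : ℚ), ((-613 : ℤ) : ℚ), ((-12 : ℤ) : ℚ), ((121470 : ℤ) : ℚ), ((-7796228 : ℤ) : ℚ)⟩ : WeierstrassCurve ℚ).IsElliptic := by
  refine ⟨isUnit_iff_ne_zero.mpr ?_⟩
  norm_num [WeierstrassCurve.Δ, WeierstrassCurve.b₂, WeierstrassCurve.b₄, WeierstrassCurve.b₆, WeierstrassCurve.b₈]

/-- `Δ`, `c₄`, `c₆` of the integer model (kernel evaluation). [folklore] -/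
private theorem invariants_model :
    discOf [1, -613, -12, 121470, -7796228] = 2852793180576 ∧
    c4Of [1, -613, -12, 121470, -7796228] = 177129 ∧
    c6Of [1, -613, -12, 121470, -7796228] = 25054731 := by
  refine ⟨?_, ?_, ?_⟩ <;> decide

/-- **`W` is globally minimal**: `Δ_W = 2852793180576 = 2⁵·3⁶·19·23⁵` is not divisible by any `q¹²`. [cite: SilvermanAEC2009, VII.1 Remark 1.1] -/
theorem isGloballyMinimal_model :
    (⟨((1 : ℤ) : ℚ), ((-613 : ℤ) : ℚ), ((-12 : ℤ) : ℚ), ((121470 : ℤ) : ℚ), ((-7796228 : ℤ) : ℚ)⟩ :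
      WeierstrassCurve ℚ).IsGloballyMinimal := by
  obtain ⟨hD, -, -⟩ := invariants_model
  refine WeierstrassCurve.isGloballyMinimal_of_int_kraus 1 (-613) (-12) 121470 (-7796228) fun q hq ↦ Or.inl fun h ↦ ?_
  obtain ⟨h12, -⟩ := h
  rw [hD] at h12
  have hq1 : (q : ℤ) ∣ 2852793180576 := dvd_trans (dvd_pow_self _ (by norm_num)) h12
  have hdvdN : q ∣ 2 ^ 5 * 3 ^ 6 * 19 * 23 ^ 5 := by
    have e : ((2 ^ 5 * 3 ^ 6 * 19 * 23 ^ 5 : ℕ) : ℤ) = 2852793180576 := by norm_num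
    exact Int.natCast_dvd_natCast.mp (e ▸ hq1)
  have hpi := Nat.Prime.prime hq
  rcases hpi.dvd_or_dvd hdvdN with h | h
  · rcases hpi.dvd_or_dvd h with h | h
    · rcases hpi.dvd_or_dvd h with h | h
      · have := (Nat.prime_dvd_prime_iff_eq hq Nat.prime_two).mp (hpi.dvd_of_dvd_pow h)
        subst this; revert h12; norm_num
      · have := (Nat.prime_dvd_prime_iff_eq hq Nat.prime_three).mp (hpi.dvd_of_dvd_pow h)
        subst this; revert h12; norm_num
    · have := (Nat.prime_dvd_prime_iff_eq hq (by norm_num : Nat.Prime 19)).mp h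
      subst this; revert h12; norm_num
  · have := (Nat.prime_dvd_prime_iff_eq hq (by norm_num : Nat.Prime 23)).mp (hpi.dvd_of_dvd_pow h)
    subst this; revert h12; norm_num

/-- The tree's integral model of `W` is the integer equation. [cite: SilvermanAEC2009, VIII.8] -/
theorem integralModelInt_model :
    haveI := isGloballyMinimal_model
    integralModelInt (⟨((1 : ℤ) : ℚ), ((-613 : ℤ) : ℚ), ((-12 : ℤ) : ℚ), ((121470 : ℤ) : ℚ), ((-7796228 : ℤ) : ℚ)⟩ : WeierstrassCurve ℚ) =
      ⟨1, -613, -12, 121470, -7796228⟩ := by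
  haveI := isGloballyMinimal_model
  apply WeierstrassCurve.map_injective (f := Int.castRingHom ℚ) Int.cast_injective
  beta_reduce
  rw [map_integralModelInt]
  ext <;> simp [WeierstrassCurve.map]

/-- The reduction of the integer model modulo `5`: `y² + xy + 3y = x³ + 2x² + 2`. [folklore] -/
private theorem map_zmod_five :
    (⟨1, -613, -12, 121470, -7796228⟩ : WeierstrassCurve ℤ).map (Int.castRingHom (ZMod 5)) =
      (⟨1, 2, 3, 0, 2⟩ : WeierstrassCurve (ZMod 5)) := by
  ext <;> simp [WeierstrassCurve.map] <;> decide

/-- **`#W̃(𝔽₅) = 7`** (`6` affine points and `O`). [cite: SilvermanAEC2009, V.2] -/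
theorem natCard_point_five :
    Nat.card (((⟨1, -613, -12, 121470, -7796228⟩ : WeierstrassCurve ℤ).map
      (Int.castRingHom (ZMod 5))).toAffine.Point) = 7 := by
  rw [map_zmod_five, natCard_point_eq_one_add_card (F := ZMod 5) _ (by decide)]
  have h : Fintype.card {xy : ZMod 5 × ZMod 5 //
      xy.2 ^ 2 + (⟨1, 2, 3, 0, 2⟩ : WeierstrassCurve (ZMod 5)).a₁ * xy.1 * xy.2 +
        (⟨1, 2, 3, 0, 2⟩ : WeierstrassCurve (ZMod 5)).a₃ * xy.2 =
      xy.1 ^ 3 + (⟨1, 2, 3, 0, 2⟩ : WeierstrassCurve (ZMod 5)).a₂ * xy.1 ^ 2 +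
        (⟨1, 2, 3, 0, 2⟩ : WeierstrassCurve (ZMod 5)).a₄ * xy.1 + (⟨1, 2, 3, 0, 2⟩ : WeierstrassCurve (ZMod 5)).a₆} = 6 := by
    decide +kernel
  rw [h]

/-- The integer discriminant of the model. [folklore] -/
private theorem Δ_model : (⟨1, -613, -12, 121470, -7796228⟩ : WeierstrassCurve ℤ).Δ = 2852793180576 := by
  norm_num [WeierstrassCurve.Δ, WeierstrassCurve.b₂, WeierstrassCurve.b₄, WeierstrassCurve.b₆, WeierstrassCurve.b₈]

/-- **`a₅(W) = −1`** (`= 5 + 1 − 7`) and **`5` is a prime of good reduction of `W`** (`5 ∤ Δ_min`): the Eisenstein prime `5` of the twist is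
NON-anomalous (`a₅ ≡ −1`, not `1`, mod `5`) and ordinary. [cite: SilvermanAEC2009, V.2 and VII.5 Prop. 5.1(a)] -/
theorem frobeniusTrace_five_model :
    haveI := isGloballyMinimal_model
    haveI : Fact (Nat.Prime 5) := ⟨Nat.prime_five⟩
    (⟨((1 : ℤ) : ℚ), ((-613 : ℤ) : ℚ), ((-12 : ℤ) : ℚ), ((121470 : ℤ) : ℚ), ((-7796228 : ℤ) : ℚ)⟩ : WeierstrassCurve ℚ).frobeniusTrace 5 = -1 ∧
      (⟨((1 : ℤ) : ℚ), ((-613 : ℤ) : ℚ), ((-12 : ℤ) : ℚ), ((121470 : ℤ) : ℚ), ((-7796228 : ℤ) : ℚ)⟩ : WeierstrassCurve ℚ).HasGoodReductionAtPrime 5 := by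
  haveI := isGloballyMinimal_model
  haveI : Fact (Nat.Prime 5) := ⟨Nat.prime_five⟩
  refine ⟨?_, hasGoodReductionAtPrime_of_not_dvd _ 5 ?_⟩
  · rw [WeierstrassCurve.frobeniusTrace, WeierstrassCurve.reductionPointCount, integralModelInt_model, natCard_point_five]
    norm_num
  · rw [minimalDiscriminantInt, integralModelInt_model, Δ_model]; norm_num

/-- **`E_{-2/23}[5]` is reducible** (the rational `5`-torsion point `(0,0)` spans a `Γ_ℚ`-stable line). [cite: Mazur1977, Ch. III §5, p. 157] -/
theorem red_five :
    haveI : Fact (Nat.Prime 5) := ⟨Nat.prime_five⟩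
    ¬ (kubertTateFive (((-2 : ℤ) : ℚ)) (((23 : ℤ) : ℚ))).HasIrreducibleModPGaloisRep 5 := by
  haveI := KubertTateM223Descent.isElliptic
  haveI : Fact (Nat.Prime 5) := ⟨Nat.prime_five⟩
  obtain ⟨P, hP⟩ := exists_addOrderOf_eq_five_kubertTateFive (F := ℚ) (m := (((-2 : ℤ) : ℚ))) (n := (((23 : ℤ) : ℚ)))
    (by norm_num) (by norm_num)
  exact not_hasIrreducibleModPGaloisRep_of_addOrderOf_eq _ hP

/-- **`W[5]` is reducible** (`W ≅ E_{-2/23}^{(-3)}`, a quadratic twist of a curve with reducible `E[5]`).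
[cite: SilvermanAEC2009, X.5 Cor. 5.4] -/
theorem red_five_model :
    haveI : Fact (Nat.Prime 5) := ⟨Nat.prime_five⟩
    ¬ (⟨((1 : ℤ) : ℚ), ((-613 : ℤ) : ℚ), ((-12 : ℤ) : ℚ), ((121470 : ℤ) : ℚ), ((-7796228 : ℤ) : ℚ)⟩ :
      WeierstrassCurve ℚ).HasIrreducibleModPGaloisRep 5 := by
  haveI := KubertTateM223Descent.isElliptic
  haveI := isElliptic_model
  haveI : Fact (Nat.Prime 5) := ⟨Nat.prime_five⟩
  exact not_hasIrreducibleModPGaloisRep_twist red_five (d := -3) (by norm_num) _ _ variableChange_model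

/-- **`(W, 5)` is a NON-anomalous Eisenstein pair of good reduction**: `Good W 5`, `Red W 5`, `¬ Anom W 5` (`a₅ = −1 ≢ 1 (mod 5)`) — the
standing hypotheses «`p > 2` Eisenstein, `φ|_{G_p} ≠ 1, ω`» of Castella–Grossi–Lee–Skinner's Theorem E in the tree's predicate names.
[cite: CastellaGrossiLeeSkinner2022, Thm. E] -/
theorem good_red_not_anom_five_model :
    haveI := isGloballyMinimal_model
    haveI : Fact (Nat.Prime 5) := ⟨Nat.prime_five⟩
    Good (⟨((1 : ℤ) : ℚ), ((-613 : ℤ) : ℚ), ((-12 : ℤ) : ℚ), ((121470 : ℤ) : ℚ), ((-7796228 : ℤ) : ℚ)⟩ : WeierstrassCurve ℚ) 5 ∧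
      Red (⟨((1 : ℤ) : ℚ), ((-613 : ℤ) : ℚ), ((-12 : ℤ) : ℚ), ((121470 : ℤ) : ℚ), ((-7796228 : ℤ) : ℚ)⟩ : WeierstrassCurve ℚ) 5 ∧
      ¬ Anom (⟨((1 : ℤ) : ℚ), ((-613 : ℤ) : ℚ), ((-12 : ℤ) : ℚ), ((121470 : ℤ) : ℚ), ((-7796228 : ℤ) : ℚ)⟩ : WeierstrassCurve ℚ) 5 := by
  haveI := isGloballyMinimal_model
  haveI : Fact (Nat.Prime 5) := ⟨Nat.prime_five⟩
  obtain ⟨ha, hgood⟩ := frobeniusTrace_five_model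
  refine ⟨hgood, red_five_model, fun hanom ↦ ?_⟩
  obtain ⟨-, -, hdvd⟩ := hanom
  rw [ha] at hdvd
  norm_num at hdvd

/-! ## §4 `rank W(ℚ) = 0` and `corank_{ℤ₅} Sel_{5^∞}(W/ℚ) = 0` -/

/-- Transport of the Mordell–Weil rank along an equality of curves. [folklore] -/
private theorem mordellWeilRank_congr {V V' : WeierstrassCurve ℚ} [V.IsElliptic] [V'.IsElliptic] (e : V = V') :
    V.mordellWeilRank = V'.mordellWeilRank := by
  subst e; rfl

/-- **`rank W(ℚ) = 0`** (transport of `rank E_{-2/23}^{(-3)}(ℚ) = 0` along the isomorphism; tree `mordellWeilRank_variableChange_holds`).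
[cite: SilvermanAEC2009, VIII.§1 and Exercise 10.16] -/
theorem mordellWeilRank_model :
    haveI := isElliptic_model
    (⟨((1 : ℤ) : ℚ), ((-613 : ℤ) : ℚ), ((-12 : ℤ) : ℚ), ((121470 : ℤ) : ℚ), ((-7796228 : ℤ) : ℚ)⟩ : WeierstrassCurve ℚ).mordellWeilRank = 0 := by
  haveI := isElliptic_model
  haveI := isElliptic_twist
  rw [← mordellWeilRank_variableChange_holds
    (⟨((1 : ℤ) : ℚ), ((-613 : ℤ) : ℚ), ((-12 : ℤ) : ℚ), ((121470 : ℤ) : ℚ), ((-7796228 : ℤ) : ℚ)⟩ : WeierstrassCurve ℚ)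
    (⟨1, 2, -1 / 2, 5⟩ : VariableChange ℚ), mordellWeilRank_congr variableChange_model]
  exact twist_M2_23.1

/-- **`corank_{ℤ₅} Sel_{5^∞}(W/ℚ) = 0`** — the hypothesis of CGLS Theorem E (`r = 0`) at the non-anomalous Eisenstein pair `(W, 5)`:
`corank Sel₅∞(W) = corank Sel₅∞(E_{-2/23}^{(-3)})` (tree `selmerCorank_eq_of_variableChange`) `= rank + t₅ = 0 + 0` (Greenberg's identity,
tree `selmerCorank_eq_mordellWeilRank_add_holds`). [cite: CastellaGrossiLeeSkinner2022, Thm. E (r = 0)] [cite: SilvermanAEC2009, Thm. X.4.2] -/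
theorem selmerCorank_model_five :
    haveI := isElliptic_model
    haveI : Fact (Nat.Prime 5) := ⟨Nat.prime_five⟩
    (⟨((1 : ℤ) : ℚ), ((-613 : ℤ) : ℚ), ((-12 : ℤ) : ℚ), ((121470 : ℤ) : ℚ), ((-7796228 : ℤ) : ℚ)⟩ : WeierstrassCurve ℚ).selmerCorank 5 = 0 := by
  haveI := isElliptic_model
  haveI := isElliptic_twist
  haveI : Fact (Nat.Prime 5) := ⟨Nat.prime_five⟩
  obtain ⟨hr, ht, -⟩ := twist_M2_23
  rw [selmerCorank_eq_of_variableChange 5 variableChange_model,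
    ((kubertTateFive (((-2 : ℤ) : ℚ)) (((23 : ℤ) : ℚ))).quadraticTwist (-3)).selmerCorank_eq_mordellWeilRank_add_holds 5, hr, ht]

end KubertTateM223EisensteinTwist

end Literature.NumberTheory.EllipticCurves

end
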